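import Summits.NavierStokesRegularity.NavierStokesRegularity.Theses.PerpetualPump
import Literature.Analysis.FunctionSpaces.LittlewoodPaley

/-!
# Sketch — crux `PerpetualPump.Thesis` (stmt-NavierStokesRegularity-1832), ideator 2, round 1

Idea `besov-envelope-floor`: measure a Type-I solution not in `L^∞` but in the
MULTIPLIER-STABLE ENVELOPE `Ḃ⁰_{∞,1}` (the smallest enlargement of `L^∞` on which Tao's slots
`m(D) ∘ Rot ∘ Dil` act boundedly, block by block), through the ENVELOPE AMPLITUDE
`a(t) = √(T-t) ‖u(t)‖_{Ḃ⁰_{∞,1}}`.  The crux then splits into three statements: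

* `AbstractLerayFloor`   — perturbative, claimed ABSTRACT (Fujita–Kato iteration in the Banach
  algebra `Ḃ⁰_{∞,1} ∩ L²` from ONE good time `t₀`; lifespan `≳ ‖u(t₀)‖_{Ḃ⁰_{∞,1}}⁻²`; no
  cancellation, no symmetry needed; constants from Tao's moment bounds);
* `EnvelopeUpgrade`      — Type I in `L^∞` ⇒ Type I in the envelope (no "log-hot" stack of
  octaves between the energy scale and the front); NEW, open even for NS as far as I know;
* `NoPersistentFront`    — the rigidity core: no mild solution keeps its envelope amplitude
  pinched in `[ε, M']` up to `T` (a persistent front is automatically an `L^∞`-Type-I blow-up, so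
  `¬ NoPersistentFront → ¬ Thesis`; likewise `¬ EnvelopeUpgrade → ¬ Thesis`).

`thesis_of_floor_upgrade_noFront` is the (proved, pure-logic) composition.
-/

noncomputable section

namespace Summit.NavierStokesRegularity.NavierStokesRegularity.Cruxes.Thesis.BesovEnvelopeFloor

open MeasureTheory Set Filter Topology
open scoped ENNReal SchwartzMap
open Literature.Analysis.FluidPDE Literature.Analysis.FluidPDE.Tao2016
open Literature.Analysis.FunctionSpaces
open Summit.NavierStokesRegularity.NavierStokesRegularity.Theses.PerpetualPump

/-- Local notation for `ℝ³`. -/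
local notation "ℝ³" => EuclideanSpace ℝ (Fin 3)
/-- Local notation for `ℂ³`. -/
local notation "ℂ³" => EuclideanSpace ℂ (Fin 3)

/-- The homogeneous Besov `Ḃ⁰_{∞,1}` norm of an `L²` class (through its tempered distribution):
`‖f‖_{Ḃ⁰_{∞,1}} = ∑_j ‖Δ̇_j f‖_{L^∞} ∈ [0,∞]` (tree `eHomBesovNorm 0 ∞ 1`). -/
def besovEnv (f : L2C) : ℝ≥0∞ :=
  eHomBesovNorm 0 ∞ 1 ((f : L2C) : 𝓢'(ℝ³, ℂ³))

/-- The ENVELOPE AMPLITUDE `a(t) = √(T - t) · ‖u(t)‖_{Ḃ⁰_{∞,1}}` of a curve `u` before time `T`. -/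
def envAmp (u : ℝ → L2C) (T t : ℝ) : ℝ≥0∞ :=
  ENNReal.ofReal (Real.sqrt (T - t)) * besovEnv (u t)

/-- **(A1) Abstract Leray floor in the Besov envelope.** For every averaging datum (no symmetry,
no cancellation needed) there is `ε > 0` such that an `H¹⁰_df`-mild solution on `[0,T)` from a
Schwartz divergence-free datum whose envelope amplitude is `≤ ε` at ONE time `t₀ < T` extends as
a mild solution past `T`.  Intended proof: local well-posedness of `∂ₜu = Δu + B̃(u,u)` in
`C([t₀,t₀+τ]; Ḃ⁰_{∞,1} ∩ L²)` with `τ = c_𝒜 ‖u(t₀)‖⁻²_{Ḃ⁰_{∞,1}} ≥ c_𝒜 (T-t₀)/ε² > T - t₀`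
(paraproduct algebra property of `Ḃ⁰_{∞,1}`; high×high→low output tamed by the `P∇·` and the time
integral, `∑_{2^l ≲ τ^{-1/2}} τ 2^l ≲ τ^{1/2}`; slots bounded block-by-block with operator norms
polynomial in the symbol seminorms, hence integrable by Tao's moment bounds; heat gain
`‖e^{σΔ}P∇·F‖_{Ḃ⁰_{∞,1}} ≲ σ^{-1/2}‖F‖_{Ḃ⁰_{∞,1}}`), uniqueness of `H¹⁰` mild solutions, and
persistence of `H¹⁰` regularity under a bounded envelope. -/
def AbstractLerayFloor : Prop :=
  ∀ 𝒜 : AveragingDatum, ∃ ε : ℝ, 0 < ε ∧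
    ∀ u₀ : 𝓢(ℝ³, ℝ³), VectorCalculus.IsDivFree ⇑u₀ → ∀ T : ℝ, 0 < T → ∀ u : ℝ → L2C,
      𝒜.IsMildSolution (schwartzL2 u₀) (Ico 0 T) u →
      (∃ t₀ ∈ Ico 0 T, envAmp u T t₀ ≤ ENNReal.ofReal ε) →
      ∃ T' : ℝ, T < T' ∧ ∃ v : ℝ → L2C,
        𝒜.IsMildSolution (schwartzL2 u₀) (Ico 0 T') v ∧ ∀ t ∈ Ico 0 T, v t = u t

/-- **(A2) Envelope upgrade ("no log-hot stack").** A Type-I bound in `L^∞` on `[0,T)` for an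
`H¹⁰_df`-mild solution of a symmetric averaged equation with cancellation (finite energy) forces a
Type-I bound in the Besov envelope: `sup_t √(T-t)‖u(t)‖_{Ḃ⁰_{∞,1}} < ∞`.  The octaves below the
energy scale `N_E(t) = (M²/(E(T-t)))^{1/3}` and above the dissipative front are geometric; the
content is that the `≈ (1/6) log₂(1/(T-t))` intermediate octaves cannot each carry the full
critical amplitude `M(T-t)^{-1/2}` (a "log-hot" satellite stack).  Failure of (A2) is itself a
Type-I blow-up, hence refutes `Thesis`. -/
def EnvelopeUpgrade : Prop :=
  ∀ 𝒜 : AveragingDatum, 𝒜.IsSymmetric → 𝒜.HasCancellation →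
    ∀ u₀ : 𝓢(ℝ³, ℝ³), VectorCalculus.IsDivFree ⇑u₀ → ∀ T : ℝ, 0 < T → ∀ u : ℝ → L2C,
      𝒜.IsMildSolution (schwartzL2 u₀) (Ico 0 T) u →
      (∃ M : ℝ, ∀ t ∈ Ico 0 T, eLpNorm (u t) ⊤ volume ≤ ENNReal.ofReal (M / Real.sqrt (T - t))) →
      ∃ M' : ℝ, ∀ t ∈ Ico 0 T, envAmp u T t ≤ ENNReal.ofReal M'

/-- **(A3) No persistent front (the rigidity core; the bet).** No `H¹⁰_df`-mild solution of a
symmetric averaged equation with cancellation, from Schwartz divergence-free data, keeps its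
envelope amplitude pinched between two positive constants on all of `[0,T)`:
`ε ≤ √(T-t)‖u(t)‖_{Ḃ⁰_{∞,1}} ≤ M'` for all `t < T` is impossible.  Such a solution is an
`L^∞`-Type-I blow-up at `T` (`‖·‖_∞ ≤ ‖·‖_{Ḃ⁰_{∞,1}}`, and it cannot extend since `H¹⁰ ⊂ Ḃ⁰_{∞,1}`),
so `¬ (A3) → ¬ Thesis`; by compactness of Type-I windows its blow-up limit is an ETERNAL
envelope-bounded similarity solution for a scale-covariant tangent datum — the object the route's
constructive cruxes (CircuitPump → PumpTransfer → AveragedTypeIBlowup) try to build. -/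
def NoPersistentFront : Prop :=
  ∀ 𝒜 : AveragingDatum, 𝒜.IsSymmetric → 𝒜.HasCancellation →
    ∀ u₀ : 𝓢(ℝ³, ℝ³), VectorCalculus.IsDivFree ⇑u₀ → ∀ T : ℝ, 0 < T → ∀ u : ℝ → L2C,
      𝒜.IsMildSolution (schwartzL2 u₀) (Ico 0 T) u →
      ∀ ε M' : ℝ, 0 < ε →
        (∀ t ∈ Ico 0 T, ENNReal.ofReal ε ≤ envAmp u T t ∧ envAmp u T t ≤ ENNReal.ofReal M') →
        False

/-- **Composition (pure logic, proved):** (A1) ∧ (A2) ∧ (A3) ⇒ `Thesis`.  Given a Type-I `u`: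
by (A2) the envelope amplitude is bounded by `M'`; either it dips below the floor `ε(𝒜)` at some
`t₀` — then (A1) extends `u` — or it stays in `[ε, M']` on `[0,T)`, which (A3) forbids. -/
theorem thesis_of_floor_upgrade_noFront
    (hF : AbstractLerayFloor) (hU : EnvelopeUpgrade) (hN : NoPersistentFront) : Thesis := by
  intro 𝒜 hs hc u₀ hdiv T hT u hmild hrate
  obtain ⟨ε, hε, hfloor⟩ := hF 𝒜
  obtain ⟨M', hM'⟩ := hU 𝒜 hs hc u₀ hdiv T hT u hmild hrate
  by_cases hdip : ∃ t₀ ∈ Ico 0 T, envAmp u T t₀ ≤ ENNReal.ofReal ε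
  · exact hfloor u₀ hdiv T hT u hmild hdip
  · push_neg at hdip
    exact (hN 𝒜 hs hc u₀ hdiv T hT u hmild ε M' hε
      (fun t ht => ⟨(hdip t ht).le, hM' t ht⟩)).elim

/-- Sanity: the envelope amplitude of the zero curve vanishes (so (A3) is not refuted by `u ≡ 0`,
whose amplitude is never `≥ ε > 0`). -/
theorem envAmp_zero (T t : ℝ) : envAmp (fun _ => (0 : L2C)) T t = 0 := by
  unfold envAmp besovEnv
  have h : (((0 : L2C) : L2C) : 𝓢'(ℝ³, ℂ³)) = 0 := by
    rw [← Lp.toTemperedDistributionCLM_apply, map_zero]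
  rw [h, eHomBesovNorm_zero, mul_zero]

end Summit.NavierStokesRegularity.NavierStokesRegularity.Cruxes.Thesis.BesovEnvelopeFloor

end
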